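import Summits.BirchSwinnertonDyer.BirchSwinnertonDyer.Theorems.GenusKolyvaginAtTwoMinimalTwinBSDTwoAllDepthCells
import Summits.BirchSwinnertonDyer.BirchSwinnertonDyer.Theorems.GenusKolyvaginAtTwoKolyvaginExclusionsOfHeegner
import HarnessLib

/-!
# Route `GenusKolyvaginAtTwo`, crux U₂ `MinimalTwinBSDTwo` (stmt-BirchSwinnertonDyer-22985), LINE 23 «twin_swap»: THE JETCHEV SPLIT ON THE EGG —
# the `Δ > 0` silent-frame exponent stub EXP⁺_all splits the same way, modulo the SIGN-FREE reading of item 27467 (Jetchev 2008 Thm. 1.4 has no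
# sign hypothesis)

Seat `bsd-line-gk2-p2` g28 (PROVER seat 2/3, cell `bsd-f1-sign2`; LINE 23 holder), `--supports stmt-BirchSwinnertonDyer-22985` (helper; closes
nothing).  Sequel of `…MinimalTwinBSDTwoJetchevSplit` (p790748: the `Δ < 0` one-bit cells, where the divisibility half of EXP⁻_all IS item 27467 at
`n = 1`).  THEOREMS ONLY (no definition, no named fact, no `sorry`); standard axioms.  **BSD is NOT proved by this file; U₂, the wall, the rank-zero
2-converse, Jetchev at 2 and NDIV⁺ are NOT proved; no item is closed.**

THE POINT.  Item 27467 `TamagawaDivisibilityAtTwo` carries the binder `W.Δ < 0` because LINE 9's KERNEL plan (Jetchev's core-vertex walk in the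
`R_M`-cyclic form) lives on `Δ < 0`; but the printed theorem it reads at `p = 2` — Jetchev 2008, Thm. 1.4, Hypothesis (∗) = «`p ∤ N` and `ρ̄_{E,p}`
onto» — has NO sign condition.  As an INPUT (beyond print at `2` either way) the sign-free text serves the `Δ > 0` EGG cells of U₂ exactly as 27467
serves the one-bit cells: with `hJpos` = the text of 27467 with `W.Δ < 0` replaced by `0 < W.Δ` DISPLAYED as a hypothesis (a reading, not a route
item; the pen may restate 27467 sign-free), **U₂|𝒮 ∩ {Δ > 0, MeetsEgg, ρ̄_{W,2} onto} ⟸ S1 + CONV₀ + hJpos + NDIV⁺ + PRINT** through the lineage's silent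
engine (`Silent.swappedPairDescentAtTwo_silent_of_facts`, gk2-p3; silent prime twin costs no Tamagawa bit), NDIV⁺ = «`P(1) ∉ 2^{ord₂ C(W)+1} W(K[1])`
at silent prime frames».  So off the identity locus, on the slice 𝒮 = {`N_W` odd, `ρ_{W,2^∞}` onto, `ord₂ C(W)` at one prime, odd-Manin optimal datum},
U₂'s research content is Jetchev-at-2 (`n = 1`) + shifted 2-primitivity, both signs.  Nothing here is progress on BSD.

References: [Jetchev2008] Thm. 1.4 (Hypothesis (∗)), Cor. 1.5; [GrossZagier1986] V.§2 (2.2); [GrossLMS1991] §4; [Kramer1981] §2 Props. 3, 6;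
[MazurRubin2010] Cor. 3.4 (i); [Darmon2004] Thm. 3.6; [Milne1972ArithmeticAV] §1 Thm. 1; [BCDTJAMS2001] Thm. A; [Miller2011LMS] Def. 1.1.
-/

set_option autoImplicit false
set_option linter.dupNamespace false -- `Summit.<P>.<Sub>` repeats `BirchSwinnertonDyer` (D-0017)

noncomputable section

open scoped Classical

open WeierstrassCurve NumberField Literature.NumberTheory.EllipticCurves
  Literature.NumberTheory.EllipticCurves.ModularForms
  Literature.NumberTheory.EllipticCurves.Rank1Residual
  Literature.NumberTheory.QuadraticFields
  Summit.BirchSwinnertonDyer.Rank1Residual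
  Summit.BirchSwinnertonDyer.Rank1Residual.AdditivePotMult
  Summit.BirchSwinnertonDyer.Rank1Residual.F1Sign2
  Summit.BirchSwinnertonDyer.BirchSwinnertonDyer.Rank1Residual
  Summit.BirchSwinnertonDyer.BirchSwinnertonDyer.Theorems
  Summit.BirchSwinnertonDyer.BirchSwinnertonDyer.Theorems.GenusExact.TwinSwap

open Summit.BirchSwinnertonDyer.BirchSwinnertonDyer.Theorems.GenusExact.TwinSwap.Ledger.Line25
  (entireLFunction_twist_one_ne_zero_of_rankZeroTwoConverse_of_natCard_selmerGroup_eq_one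
    not_isOfFinAddOrder_derivedPoint_one_of_rankOne_of_lValue_ne_zero exists_silentPrime_heegnerField_selmerTrivialTwin_of_GZK)
open Summit.BirchSwinnertonDyer.BirchSwinnertonDyer.Theorems.GenusExact.TwinSwap.Silent
  (swappedPairDescentAtTwo_silent_of_facts padicValNat_two_tamagawaProduct_twin_eq_of_discr_eq_neg_prime_of_noRoot)
open Summit.BirchSwinnertonDyer.BirchSwinnertonDyer.Theorems.GenusExact
  (not_isSquare_discr_mul_neg_abs_Δ_of_odd not_isSquare_discr_mul_neg_two_mul_abs_Δ_of_odd)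
open Summit.BirchSwinnertonDyer.Rank1Residual.F1Sign2 (MeetsEgg)

namespace Summit.BirchSwinnertonDyer.BirchSwinnertonDyer.Theorems.GenusExact.TwinSwap.JetchevSplitEgg

/-! ## §1 The egg side: the split modulo the SIGN-FREE reading of Jetchev at 2 -/

/-- ★ **U₂ ON THE `Δ > 0` EGG SLICE, FROM THE WALL, THE RANK-ZERO 2-CONVERSE, THE SIGN-FREE READING OF JETCHEV AT 2 AND SHIFTED 2-PRIMITIVITY.**
Item 27467 carries the binder `W.Δ < 0` (LINE 9's kernel plan runs on the `R_M`-cyclic `Δ < 0` frame), but Jetchev 2008 Thm. 1.4 has NO sign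
hypothesis (Hypothesis (∗) = `p ∤ N` + `ρ̄_{E,p}` onto); so the egg cells admit the same split modulo the displayed hypothesis `hJpos` = THE TEXT OF
27467 WITH `W.Δ < 0` REPLACED BY `0 < W.Δ` (a READING, not a route item — the pen may restate 27467 sign-free).  Hypotheses: PRINT, `hS1`, `hC0` as in
§3; `hJpos`; `hNDIVpos` = NDIV⁺: for `W` non-CM, `r_an = 1`, `#Sel₂ = 2`, `ρ̄_{W,2}` onto, `Δ > 0`, `MeetsEgg W`, `N_W` odd, `ρ_{W,2^∞}` onto, the `2`-part
of `C(W)` at one prime, at EVERY silent prime Heegner field `K = ℚ(√−ℓ)` (the `2`-division cubic rootless mod `ℓ`, `d_K` odd `≠ −3`, Heegner) with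
`L(W^{(d_K)},1) ≠ 0`, EVERY optimal datum with odd Manin constant and EVERY conductor-`1` datum on it: **`P(1) ∉ 2^{ord₂ C(W)+1} W(K[1])`**.  CONCLUSION:
`BSD₂(W)` on the egg slice {`r_an = 1`, `#Sel₂ = 2`, `ρ̄_{W,2}` onto, `Δ > 0`, `MeetsEgg`, `N_W` odd, `ρ_{W,2^∞}` onto, optimal odd-Manin datum, `ord₂ c_{q₀} =
ord₂ C(W)`}.  Proof: the silent prime Heegner field with a globally minimal `2`-Selmer-trivial twin costing no bit (p775371, p770721); CONV₀ for the
`L`-value; the conductor-`1` datum on the odd-Manin optimal datum; DIV by `hJpos` at `n = 1` (exclusions automatic at odd `d_K`); NDIV by `hNDIVpos`;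
`Silent.swappedPairDescentAtTwo_silent_of_facts`.  CONDITIONAL; proves nothing about BSD; closes nothing.
[cite: Jetchev2008, Thm. 1.4 (Hypothesis (∗): no sign condition)] [cite: GrossZagier1986, V.§2 (2.2)] [cite: Kramer1981, §2 Props. 3, 6]
[cite: MazurRubin2010, Cor. 3.4 (i)] [cite: Darmon2004, Thm. 3.6] [cite: Milne1972ArithmeticAV, §1 Thm. 1] [cite: Miller2011LMS, Def. 1.1] -/
theorem bsdp_posDisc_egg_of_wall_of_converse_of_jetchevSignFree_of_ndiv_of_facts
    (hGZ : ∀ (N : ℕ) [NeZero N] (W : WeierstrassCurve ℚ) (K : Type) [Field K] [NumberField K], gross_zagier N W K)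
    (hGZK : rank_eq_analyticRank_of_analyticRank_le_one) (hmod : hasEntireLFunction_rat)
    (hMilneC : Milne1972.bsdQuotient_baseChange_quadratic_anyModel)
    (hS1 : ∀ (W : WeierstrassCurve ℚ) [W.IsElliptic] [W.IsGloballyMinimal],
      ¬ W.HasCM → W.analyticRank = 0 → Nat.card (W.selmerGroup 2) = 1 → BSDp W 2)
    (hC0 : ∀ (V : WeierstrassCurve ℚ) [V.IsElliptic] [V.IsGloballyMinimal], ¬ V.HasCM → V.selmerCorank 2 = 0 → V.analyticRank = 0)
    (hJpos : ∀ (W : WeierstrassCurve ℚ) [W.IsElliptic] [W.IsGloballyMinimal] [NeZero (W.conductorNorm ℤ)], ¬ W.HasCM → 0 < W.Δ →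
      ∀ (K : Type) [Field K] [NumberField K], IsImaginaryQuadratic K → NumberField.discr K ≠ -3 → NumberField.discr K ≠ -4 →
      SatisfiesHeegnerHypothesis (W.conductorNorm ℤ) K → ¬ 2 ∣ W.conductorNorm ℤ →
      ¬ IsSquare ((NumberField.discr K : ℚ) * -|W.Δ|) → ¬ IsSquare ((NumberField.discr K : ℚ) * (-(2 * |W.Δ|))) →
      (∀ n : ℕ, 0 < n → W.HasSurjectiveModNGaloisRep ((2 : ℤ) ^ n)) →
      (∃ Dt₀ : ModularParametrizationData W (W.conductorNorm ℤ), ∀ z ∈ Dt₀.L.lattice, ∃ w ∈ periodLattice Dt₀.f, z = (Dt₀.c : ℂ) * w) →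
      ∀ (Dt : ModularParametrizationData W (W.conductorNorm ℤ)) (β : ℤ) (ι : K →+* ℂ) (d₁ : KolyvaginHeegnerData Dt β ι 1),
        ¬ IsOfFinAddOrder d₁.derivedPoint → ∀ (q : ℕ) [Fact q.Prime], (q : ℤ) ∣ W.conductorNorm ℤ →
        ∀ (s : ℕ), s ≤ padicValNat 2 ((W.baseChange ℚ_[q]).localTamagawaNumber ℤ_[q]) →
        ∀ (n : ℕ) (d : KolyvaginHeegnerData Dt β ι n), Squarefree n →
          (∀ ℓ ∈ n.primeFactors, Zhang2014.IsKolyvaginPrime (W.conductorNorm ℤ) W K 2 ℓ ∧ s ≤ Zhang2014.kolyvaginIndex W 2 ℓ) →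
          ∃ Q : (W.baseChange (ringClassField K ι n)).toAffine.Point, ((2 ^ s : ℕ) : ℤ) • Q = d.derivedPoint)
    (hNDIVpos : ∀ (W : WeierstrassCurve ℚ) [W.IsElliptic] [W.IsGloballyMinimal] [NeZero (W.conductorNorm ℤ)],
      ¬ W.HasCM → W.analyticRank = 1 → Nat.card (W.selmerGroup 2) = 2 → W.HasSurjectiveModNGaloisRep 2 → 0 < W.Δ → MeetsEgg W →
      ¬ 2 ∣ W.conductorNorm ℤ → (∀ n : ℕ, 0 < n → W.HasSurjectiveModNGaloisRep ((2 : ℤ) ^ n)) →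
      (∃ (q₀ : ℕ) (_ : Fact q₀.Prime), (q₀ : ℤ) ∣ W.conductorNorm ℤ ∧
        padicValNat 2 ((W.baseChange ℚ_[q₀]).localTamagawaNumber ℤ_[q₀]) = padicValNat 2 W.tamagawaProduct) →
      ∀ (K : Type) [Field K] [NumberField K], IsImaginaryQuadratic K →
        ∀ (ℓ : ℕ), ℓ.Prime → NumberField.discr K = -(ℓ : ℤ) →
        (∀ x : ZMod ℓ, 4 * x ^ 3 + ((integralModelInt W).b₂ : ZMod ℓ) * x ^ 2 +
            2 * ((integralModelInt W).b₄ : ZMod ℓ) * x + ((integralModelInt W).b₆ : ZMod ℓ) ≠ 0) →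
        Odd (NumberField.discr K) → NumberField.discr K ≠ -3 → SatisfiesHeegnerHypothesis (W.conductorNorm ℤ) K →
        (W.quadraticTwist (NumberField.discr K : ℚ)).entireLFunction 1 ≠ 0 →
        ∀ (Dt : ModularParametrizationData W (W.conductorNorm ℤ)),
          (∀ z ∈ Dt.L.lattice, ∃ w ∈ periodLattice Dt.f, z = (Dt.c : ℂ) * w) → Odd Dt.c →
        ∀ (β : ℤ) (ι : K →+* ℂ) (d₁ : KolyvaginHeegnerData Dt β ι 1),
          ¬ ∃ Q : (W.baseChange (ringClassField K ι 1)).toAffine.Point,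
            ((2 ^ (padicValNat 2 W.tamagawaProduct + 1) : ℕ) : ℤ) • Q = d₁.derivedPoint) :
    ∀ (W : WeierstrassCurve ℚ) [W.IsElliptic] [W.IsGloballyMinimal] [NeZero (W.conductorNorm ℤ)], ¬ W.HasCM → W.analyticRank = 1 →
      Nat.card (W.selmerGroup 2) = 2 → W.HasSurjectiveModNGaloisRep 2 → 0 < W.Δ → MeetsEgg W → ¬ 2 ∣ W.conductorNorm ℤ →
      (∀ n : ℕ, 0 < n → W.HasSurjectiveModNGaloisRep ((2 : ℤ) ^ n)) →
      (∃ Dt : ModularParametrizationData W (W.conductorNorm ℤ),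
        (∀ z ∈ Dt.L.lattice, ∃ w ∈ periodLattice Dt.f, z = (Dt.c : ℂ) * w) ∧ Odd Dt.c) →
      (∃ (q₀ : ℕ) (_ : Fact q₀.Prime), (q₀ : ℤ) ∣ W.conductorNorm ℤ ∧
        padicValNat 2 ((W.baseChange ℚ_[q₀]).localTamagawaNumber ℤ_[q₀]) = padicValNat 2 W.tamagawaProduct) →
      BSDp W 2 := by
  intro W _ _ _ hcm hr hSel hsurj hΔ hegg hN hρ hopt hq₀
  -- the silent prime Heegner field with its globally minimal Sel₂-trivial twin (the egg decides), costing no Tamagawa bit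
  obtain ⟨K, _, _, ℓ, hℓ, hK, hd, hsil, hodd, h3, hH, -, Wd, _, _, Cd, hCd, hSel1⟩ :=
    exists_silentPrime_heegnerField_selmerTrivialTwin_of_GZK hGZK W hΔ hsurj hr hSel hegg
  have hD0 : (NumberField.discr K : ℚ) ≠ 0 := by exact_mod_cast NumberField.discr_ne_zero K
  haveI := W.isElliptic_quadraticTwist hD0
  have hSil : padicValNat 2 Wd.tamagawaProduct = padicValNat 2 W.tamagawaProduct :=
    padicValNat_two_tamagawaProduct_twin_eq_of_discr_eq_neg_prime_of_noRoot W hK hodd hH hℓ hd hsil Cd hCd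
  -- the central value through the rank-zero 2-converse
  have hL : (W.quadraticTwist (NumberField.discr K : ℚ)).entireLFunction 1 ≠ 0 :=
    entireLFunction_twist_one_ne_zero_of_rankZeroTwoConverse_of_natCard_selmerGroup_eq_one hC0 hmod W hcm hD0 Wd hCd hSel1
  -- the conductor-1 datum ON THE ODD-MANIN OPTIMAL DATUM, its Heegner point of infinite order
  obtain ⟨Dt, hlat, hc⟩ := hopt
  obtain ⟨β, hβ⟩ : ∃ β : ℤ, (4 * (W.conductorNorm ℤ : ℕ) : ℤ) ∣ β ^ 2 - NumberField.discr K :=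
    Quadratic.exists_dvd_sq_sub_discr_of_ncard_primesOver hK.1 (NeZero.ne _) hH
  obtain ⟨ι⟩ : Nonempty (K →+* ℂ) := inferInstance
  obtain ⟨d₁⟩ := exists_kolyvaginHeegnerData_one (phi_heegnerTau_mem_singularModuliField_holds (W.conductorNorm ℤ) W K) hK Dt β ι hβ
  have hc0 : Dt.c ≠ 0 := fun h ↦ Dt.cast_c_ne_zero (by rw [h, Int.cast_zero])
  have hy : ¬ IsOfFinAddOrder d₁.derivedPoint :=
    not_isOfFinAddOrder_derivedPoint_one_of_rankOne_of_lValue_ne_zero hmod W K (hGZ _ W K) hK hH hr hL d₁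
  have hc2 : padicValInt 2 Dt.c = 0 :=
    padicValInt.eq_zero_of_not_dvd fun h ↦ (Int.not_even_iff_odd.mpr hc) (even_iff_two_dvd.mpr (by exact_mod_cast h))
  have h4 : NumberField.discr K ≠ -4 := fun h ↦ by
    rw [h] at hodd
    exact (Int.not_even_iff_odd.mpr hodd) ⟨-2, by norm_num⟩
  -- DIV from the sign-free reading at `n = 1`, NDIV from `hNDIVpos`
  obtain ⟨q₀, hq₀F, hq₀N, hconc⟩ := hq₀
  have hdiv : ∃ Q : (W.baseChange (ringClassField K ι 1)).toAffine.Point,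
      ((2 ^ (padicValInt 2 Dt.c + padicValNat 2 W.tamagawaProduct) : ℕ) : ℤ) • Q = d₁.derivedPoint := by
    rw [hc2, zero_add, ← hconc]
    exact hJpos W hcm hΔ K hK h3 h4 hH hN (not_isSquare_discr_mul_neg_abs_Δ_of_odd W hK hodd hH)
      (not_isSquare_discr_mul_neg_two_mul_abs_Δ_of_odd W hK hodd hH) hρ ⟨Dt, hlat⟩ Dt β ι d₁ hy q₀ hq₀N _ le_rfl 1 d₁ squarefree_one
      (fun ℓ' hℓ' ↦ absurd hℓ' (by rw [Nat.primeFactors_one]; exact Finset.notMem_empty ℓ'))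
  have hndiv : ¬ ∃ Q : (W.baseChange (ringClassField K ι 1)).toAffine.Point,
      ((2 ^ (padicValInt 2 Dt.c + padicValNat 2 W.tamagawaProduct + 1) : ℕ) : ℤ) • Q = d₁.derivedPoint := by
    rw [hc2, zero_add]
    exact hNDIVpos W hcm hr hSel hsurj hΔ hegg hN hρ ⟨q₀, hq₀F, hq₀N, hconc⟩ K hK ℓ hℓ hd hsil hodd h3 hH hL Dt hlat hc β ι d₁
  -- the twin is non-CM of analytic rank 0: `BSD₂(Wd)` from the wall
  have hcmd : ¬ Wd.HasCM := by
    rw [← hCd, hasCM_iff_of_j_eq (((W.quadraticTwist (NumberField.discr K : ℚ)).variableChange_j Cd).trans (W.j_quadraticTwist hD0))]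
    exact hcm
  have hrd : Wd.analyticRank = 0 := by
    rw [← hCd, analyticRank_smul]
    exact ((W.quadraticTwist (NumberField.discr K : ℚ)).analyticRank_eq_zero_iff_holds (hmod _)).mpr hL
  have hBd : BSDp Wd 2 := hS1 Wd hcmd hrd hSel1
  exact swappedPairDescentAtTwo_silent_of_facts hGZ hGZK hmod hMilneC W hr hSel K hK hodd h3 hH Dt hc0 β ι d₁ hy hdiv hndiv
    Wd ⟨Cd, hCd⟩ hSel1 hSil hBd

end Summit.BirchSwinnertonDyer.BirchSwinnertonDyer.Theorems.GenusExact.TwinSwap.JetchevSplitEgg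

end
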